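import Literature.Topology.FourManifolds.CappellShanesonGompfReduction
import Literature.Topology.FourManifolds.GompfStraightening
import Literature.Topology.FourManifolds.SectionCircleNbhd
import Literature.Topology.FourManifolds.CircleSurgeryExistence
import Literature.Topology.FourManifolds.GluingUniqueness
import HarnessLib

/-!
# Gompf's framed Cappell–Shaneson spheres `X^σ_A`: Theorem 4.3 and [AK1] as framed leaves

Fourth file of the decomposition of the named fact
`Literature.Topology.FourManifolds.nonempty_diffeomorph_sphere_four_of_isCappellShanesonSphereOf` (R. Gompf, *More
Cappell–Shaneson spheres are standard*, Algebr. Geom. Topol. 10 (2010), Examples 3.1(a)) along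
Gompf's proof. `CappellShanesonGompfReduction.lean` reduced it to three leaves; the second and third,
`Literature.Topology.FourManifolds.gompf2010_akbulutKirby_framings` (Thm 4.3: the two spheres of `A₀` are diffeomorphic, in the
framing-free form "any two Cappell–Shaneson spheres of `A₀` are diffeomorphic") and
`Literature.Topology.FourManifolds.akbulutKirby1979_sphere_four` ([AK1]: one of them is `S⁴`), are **proved here** from sharper,
*framed* leaves stated for Gompf's concrete manifolds `X^σ_A`.

Gompf, §4: the framing of the surgery is fixed by a *straightening* `σ` of `A` (Def. 4.1, a
homotopy class of paths from `A` to `I` in `GL(3, ℝ)`), and `X^σ_A` denotes the resulting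
diffeomorphism type; "the two straightenings `σ` … canonically determine the two possible isotopy
classes (rel a neighborhood of `p`) of monodromies for the Cappell–Shaneson construction … and hence
the two resulting diffeomorphism types, which we denote by `X^σ`. (… Changing the framing is
equivalent to changing `σ`.)" The tree already contains this construction concretely
(`SectionCircleNbhd.lean`, `CircleSurgeryExistence.lean`): for a smooth path
`γ : SmoothMatrixPath (slRealMatrix A)` from `1` to `A` — a representative of a straightening — the
glued mapping torus `CSTorus A`, its section circle `sectionCircle A γ`, the tubular neighbourhood
`sectionCircleNbhd A γ` framed by `γ`, and the surgered manifold `CircleNbhd.Surgered`. We set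

* `Literature.gompfSphere A γ := (sectionCircleNbhd A γ).Surgered` — Gompf's `X^σ_A` for `σ = [γ]`
  (a closed smooth 4-manifold in `Type`; `Literature.Topology.FourManifolds.isCappellShanesonSphereOf_gompfSphere`, proved);
* `Literature.linearStraighteningPath M h : SmoothMatrixPath M` — the *linear straightening* `σ_M` of a
  linearly straightenable `M` (Prop. 4.2, `GompfStraightening.lean`), the segment `t M + (1 - t) I`
  reparametrised by `Real.smoothTransition` (proved smooth with smooth inverse); in particular
  `Literature.Topology.FourManifolds.akbulutKirbyLinearPath`, the linear straightening of `A₀` (trace `2 ≥ 0`);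

record the chain of four Δ/Δ₀-moves `A ↦ Δ²A ↦ (Δ²A)Δ₀² ↦ (Δ²AΔ₀²)Δ² = A₀ ↦ Δ²A₀ = B = CAC⁻¹`
of the proof of Theorem 4.3 as matrix identities (`Literature.Topology.FourManifolds.gompfDeltaZero`, `Literature.Topology.FourManifolds.gompf_chain`, proved);
prove the **reduction to the concrete mapping torus** — uniqueness of open gluings *with
witnesses* (`Literature.Topology.FourManifolds.IsOpenGluingWith.exists_diffeomorph_apply_eq`, Kosinski VI.1), transport of
tubes and of circle surgery along a diffeomorphism of the ambient manifold (`Literature.Topology.FourManifolds.CircleNbhd.map`,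
`Literature.Topology.FourManifolds.IsCircleSurgery.map_diffeomorph`) and hence
`Literature.Topology.FourManifolds.IsCappellShanesonSphereOf.exists_isCircleSurgery_csTorus`: every Cappell–Shaneson sphere of
`A` is a circle surgery on `CSTorus A` along *some* parametrisation and *some* tube of the standard
section circle; and vendor the framed leaves

* `Literature.Topology.FourManifolds.gompf2010_sectionCircle_framings` — the two framings of the section circle (§4 ¶2 with
  Kosinski's uniqueness of tubular neighbourhoods III.3.1/III.3.5 and isotopy extension II.5.2):
  every circle surgery on `CSTorus A` along the standard section circle (any parametrisation, any
  tube) is diffeomorphic to some `X^σ_A = gompfSphere A γ`; from it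
  `Literature.Topology.FourManifolds.gompf2010_straightening_classification` (same conclusion for every Cappell–Shaneson
  sphere of `A` in the sense of the tree's predicate) is **proved**
  (`Literature.Topology.FourManifolds.gompf2010_straightening_classification_of_sectionCircle`);
* `Literature.Topology.FourManifolds.gompf2010_thm43` — **Theorem 4.3**: all `gompfSphere A₀ γ` are diffeomorphic to each other;
* `Literature.Topology.FourManifolds.akbulutKirby1979_linearStraightening` — **[AK1]**: `gompfSphere A₀ σ_lin ≅ S⁴` for the
  linear straightening ("[AK1] for the linear straightening of `A₀`", loc. cit. after Thm 4.3);

from which `gompf2010_akbulutKirby_framings` and `akbulutKirby1979_sphere_four` follow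
(`Literature.Topology.FourManifolds.gompf2010_akbulutKirby_framings_of_framed`, `Literature.Topology.FourManifolds.akbulutKirby1979_sphere_four_of_framed`,
proved), and hence the assembly
`Literature.Topology.FourManifolds.nonempty_diffeomorph_sphere_four_of_isCappellShanesonSphereOf_of_framed`.

## References

* R. E. Gompf, *More Cappell–Shaneson spheres are standard*, Algebr. Geom. Topol. 10 (2010)
  1665–1681, doi:10.2140/agt.2010.10.1665 (arXiv:0908.1914): §4 (Def. 4.1, the manifolds `X^σ_φ`,
  Prop. 4.2, Thm 4.3). [GompfAGT2010]
* S. Akbulut, R. Kirby, *An exotic involution of `S⁴`*, Topology 18 (1979) 75–81. [AkbulutKirby1979]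
* A. Kosinski, *Differential Manifolds* (1993), II.5.2 (isotopy extension), III.3.1/III.3.5
  (uniqueness of tubular neighbourhoods), VI.1–2 (gluing, surgery). [Kosinski1993]
* R. Gompf, A. Stipsicz, *4-Manifolds and Kirby Calculus* (1999), §5.2 (surgery on a framed
  circle is well defined up to diffeomorphism). [GompfStipsicz1999]
-/

open scoped Manifold ContDiff Topology
open Set Function Matrix

noncomputable section

namespace Literature.Topology.FourManifolds

universe u v

/-- Local notation: `𝔼 n` is the model Euclidean space `EuclideanSpace ℝ (Fin n)`. -/
local notation "𝔼 " n:arg => EuclideanSpace ℝ (Fin n)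

/-- Local notation: `𝕊 n` is the unit sphere in `EuclideanSpace ℝ (Fin (n + 1))`. -/
local notation "𝕊 " n:arg => (Metric.sphere (0 : EuclideanSpace ℝ (Fin (n + 1))) 1)

/-- Local notation: the model with corners `𝓣 = (𝓡 1).prod ((𝓡 1).prod (𝓡 1))` of `ThreeTorus`. -/
local notation "𝓣" =>
  (ModelWithCorners.prod (𝓡 1) (ModelWithCorners.prod (𝓡 1) (𝓡 1)))

/-! ### Gompf's concrete spheres `X^σ_A` -/

section Spheres

variable (A : Matrix.SpecialLinearGroup (Fin 3) ℤ) (γ : SmoothMatrixPath (slRealMatrix A))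

/-- **Gompf's Cappell–Shaneson sphere `X^σ_A` with straightening `σ = [γ]`**, concretely: the
result `(sectionCircleNbhd A γ).Surgered` of surgery (`CircleSurgeryExistence.lean`) on the glued
mapping torus `CSTorus A` of `torusDiffeomorph A` along the section circle through `1`, with the
tubular neighbourhood `sectionCircleNbhd A γ` framed by the smooth path `γ` from `1` to `A`
(`SectionCircleNbhd.lean`) — Gompf's straightened-then-untwisted-surgery description of `X^σ`
(Gompf 2010, §4: "For each `σ` we straighten and then surger with the untwisted framing. Changing
the framing is equivalent to changing `σ`"). [cite: GompfAGT2010, §4 (the manifolds X^σ, after Def. 4.1)] -/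
abbrev gompfSphere : Type := (sectionCircleNbhd A γ).Surgered

/-- **`X^σ_A` is a Cappell–Shaneson sphere of `A`** in the sense of the tree's predicate (for
`det (A - 1) = ±1`): the witnesses are the glued mapping torus, its gluing embeddings, the section
circle, the framed tube and the surgery gluing (all constructed in the tree). [cite: GompfAGT2010, §4 (the manifolds X^σ, after Def. 4.1)] -/
theorem isCappellShanesonSphereOf_gompfSphere
    (hA : ((A : Matrix (Fin 3) (Fin 3) ℤ) - 1).det = 1 ∨ ((A : Matrix (Fin 3) (Fin 3) ℤ) - 1).det = -1) :
    IsCappellShanesonSphereOf A (gompfSphere A γ) :=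
  ⟨hA, CSTorus A, inferInstance, inferInstance, inferInstance, inferInstance, inferInstance,
    inferInstance, (csGlueData A).inl, (csGlueData A).inr, isOpenGluingWith_mappingTorusGlued _ _,
    sectionCircle A γ, isSmoothEmbedding_sectionCircle A γ, range_sectionCircle A γ,
    sectionCircleNbhd A γ, (sectionCircleNbhd A γ).isOpenGluing_surgered⟩

/-- In particular for the Akbulut–Kirby matrix `A₀` (`det (A₀ - 1) = 1`). [cite: GompfAGT2010, §4 (the manifolds X^σ, after Def. 4.1)] -/
theorem isCappellShanesonSphereOf_gompfSphere_akbulutKirby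
    (γ : SmoothMatrixPath (slRealMatrix akbulutKirbyMatrix)) :
    IsCappellShanesonSphereOf akbulutKirbyMatrix (gompfSphere akbulutKirbyMatrix γ) :=
  isCappellShanesonSphereOf_gompfSphere _ γ (Or.inl (by decide))

end Spheres

/-! ### Uniqueness of open gluings with witnesses; transport of circle surgery -/

section GluingUniqueWith

variable {EA HA EB HB EP HP HP' : Type*}
  [NormedAddCommGroup EA] [NormedSpace ℝ EA] [TopologicalSpace HA] {IA : ModelWithCorners ℝ EA HA}
  [NormedAddCommGroup EB] [NormedSpace ℝ EB] [TopologicalSpace HB] {IB : ModelWithCorners ℝ EB HB}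
  [NormedAddCommGroup EP] [NormedSpace ℝ EP] [TopologicalSpace HP] {IP : ModelWithCorners ℝ EP HP}
  [TopologicalSpace HP'] {IP' : ModelWithCorners ℝ EP HP'}
  {P P' : Type*} {M N : Type*} [TopologicalSpace M] [ChartedSpace HA M] [TopologicalSpace N]
  [ChartedSpace HB N]
  [TopologicalSpace P] [ChartedSpace HP P] [TopologicalSpace P'] [ChartedSpace HP' P']
  {jA : M → P} {jB : N → P} {jA' : M → P'} {jB' : N → P'}

/-- **Uniqueness of open gluings, with witnesses.** Two open gluings `P`, `P'` of the same pieces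
`M`, `N` along the same relation `R`, with gluing embeddings `jA, jB` and `jA', jB'`, are
diffeomorphic *by a diffeomorphism `e` with `e ∘ jA = jA'` and `e ∘ jB = jB'`* — the comparison
map of `IsOpenGluing.nonempty_diffeomorph` (`GluingUniqueness.lean`), whose proof is repeated
keeping track of the witnesses (Kosinski, *Differential Manifolds*, Ch. VI §1, proof of Thm (1.1):
"the unique structure for which the projections are diffeomorphisms"). [cite: Kosinski1993, Ch. VI §1, proof of Thm (1.1)] -/
theorem IsOpenGluingWith.exists_diffeomorph_apply_eq [IsManifold IP ∞ P] [IsManifold IP' ∞ P']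
    {R : M → N → Prop} (h : IsOpenGluingWith IA IB IP R jA jB)
    (h' : IsOpenGluingWith IA IB IP' R jA' jB') :
    ∃ e : P ≃ₘ⟮IP, IP'⟯ P', (∀ a, e (jA a) = jA' a) ∧ ∀ b, e (jB b) = jB' b := by
  obtain ⟨hA, hAo, hB, hBo, hU, hR⟩ := h
  obtain ⟨hA', hAo', hB', hBo', hU', hR'⟩ := h'
  have hRR' : ∀ a b, jA a = jB b → jA' a = jB' b := fun a b hab => (hR' a b).2 ((hR a b).1 hab)
  have hR'R : ∀ a b, jA' a = jB' b → jA a = jB b := fun a b hab => (hR a b).2 ((hR' a b).1 hab)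
  obtain ⟨G, hGA, hGB⟩ := IsOpenGluing.exists_map_apply_eq hU hA.isEmbedding.injective
    hB.isEmbedding.injective hRR'
  obtain ⟨G', hGA', hGB'⟩ := IsOpenGluing.exists_map_apply_eq hU' hA'.isEmbedding.injective
    hB'.isEmbedding.injective hR'R
  refine ⟨{ toFun := G
            invFun := G'
            left_inv := fun p => ?_
            right_inv := fun p => ?_
            contMDiff_toFun := IsOpenGluing.contMDiff_of_comp_eq hA hAo hB hBo hU hA'.contMDiff
              hB'.contMDiff hGA hGB
            contMDiff_invFun := IsOpenGluing.contMDiff_of_comp_eq hA' hAo' hB' hBo' hU'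
              hA.contMDiff hB.contMDiff hGA' hGB' }, hGA, hGB⟩
  · rcases eq_univ_iff_forall.1 hU p with ⟨a, rfl⟩ | ⟨b, rfl⟩
    · show G' (G (jA a)) = jA a
      rw [hGA, hGA']
    · show G' (G (jB b)) = jB b
      rw [hGB, hGB']
  · rcases eq_univ_iff_forall.1 hU' p with ⟨a, rfl⟩ | ⟨b, rfl⟩
    · show G (G' (jA' a)) = jA' a
      rw [hGA', hGA]
    · show G (G' (jB' b)) = jB' b
      rw [hGB', hGB]

end GluingUniqueWith

section CircleTransport

variable {T T' : Type*} [TopologicalSpace T] [ChartedSpace (𝔼 4) T] [TopologicalSpace T']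
  [ChartedSpace (𝔼 4) T'] [IsManifold (𝓡 4) ∞ T] [IsManifold (𝓡 4) ∞ T']

/-- **Transport of a tubular neighbourhood of a circle along a diffeomorphism** of the ambient
4-manifold: `e ∘ ν` is a tubular neighbourhood of the circle `e ∘ c` (a smooth embedding followed
by a diffeomorphism is a smooth embedding, `Manifold.IsSmoothEmbedding.diffeomorph_comp`). [folklore] -/
def CircleNbhd.map {c : 𝕊 1 → T} (ν : CircleNbhd (𝓡 4) c) (e : T ≃ₘ⟮𝓡 4, 𝓡 4⟯ T') :
    CircleNbhd (𝓡 4) (e ∘ c) where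
  toFun := e ∘ ν.toFun
  isSmoothEmbedding := ν.isSmoothEmbedding.diffeomorph_comp e
  isOpen_range := by
    rw [Set.range_comp]
    exact e.toHomeomorph.isOpenMap _ ν.isOpen_range
  apply_zero u := by simp only [Function.comp_apply, ν.apply_zero]

/-- The transported tube, pointwise. [folklore] -/
@[simp] theorem CircleNbhd.map_apply {c : 𝕊 1 → T} (ν : CircleNbhd (𝓡 4) c)
    (e : T ≃ₘ⟮𝓡 4, 𝓡 4⟯ T') (q : (𝕊 1) × (𝔼 3)) : (ν.map e).toFun q = e (ν.toFun q) := rfl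

variable [T2Space T] [T2Space T']

/-- A diffeomorphism `e` of the ambient manifold restricts to a diffeomorphism between the
complements (open submanifolds) of the circles `c` and `e ∘ c`. [folklore] -/
def CircleNbhd.complementMap {c : 𝕊 1 → T} (ν : CircleNbhd (𝓡 4) c)
    (e : T ≃ₘ⟮𝓡 4, 𝓡 4⟯ T') : ↥ν.complement ≃ₘ⟮𝓡 4, 𝓡 4⟯ ↥(ν.map e).complement where
  toFun a := ⟨e a, by
    rintro ⟨u, hu⟩
    exact a.2 ⟨u, e.injective hu⟩⟩
  invFun a' := ⟨e.symm a', by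
    rintro ⟨u, hu⟩
    refine a'.2 ⟨u, ?_⟩
    show e (c u) = a'
    rw [hu, Diffeomorph.apply_symm_apply]⟩
  left_inv a := Subtype.ext (e.symm_apply_apply a)
  right_inv a' := Subtype.ext (e.apply_symm_apply a')
  contMDiff_toFun := by
    refine (ContMDiff.subtypeVal_comp_iff _ _).1 ?_
    exact e.contMDiff.comp contMDiff_subtype_val
  contMDiff_invFun := by
    refine (ContMDiff.subtypeVal_comp_iff _ _).1 ?_
    exact e.symm.contMDiff.comp contMDiff_subtype_val

/-- The inverse of the restricted diffeomorphism, pointwise. [folklore] -/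
@[simp] theorem CircleNbhd.coe_complementMap_symm_apply {c : 𝕊 1 → T} (ν : CircleNbhd (𝓡 4) c)
    (e : T ≃ₘ⟮𝓡 4, 𝓡 4⟯ T') (a' : ↥(ν.map e).complement) :
    ((ν.complementMap e).symm a' : T) = e.symm a' := rfl

/-- **Circle surgery is transported along diffeomorphisms of the ambient manifold.** If `X` is
obtained from `T` by surgery on the circle `c` (`IsCircleSurgery`, with tube `ν`) and
`e : T ≅ T'`, then `X` is obtained from `T'` by surgery on `e ∘ c`, with tube `e ∘ ν`: precompose
the embedding of the complement `T ∖ c` into `X` with the restriction of `e⁻¹`; the gluing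
relation is unchanged because both tubes carry the same polar coordinates (Kosinski,
*Differential Manifolds*, VI.1, proof of Thm (1.1), transport of gluings; Gompf–Stipsicz, §5.2). [folklore] -/
theorem IsCircleSurgery.map_diffeomorph {X : Type*} [TopologicalSpace X] [ChartedSpace (𝔼 4) X]
    {c : 𝕊 1 → T} (h : IsCircleSurgery (𝓡 4) (𝓡 4) T X c) (e : T ≃ₘ⟮𝓡 4, 𝓡 4⟯ T') :
    IsCircleSurgery (𝓡 4) (𝓡 4) T' X (e ∘ c) := by
  obtain ⟨ν, jA, jB, hA, hAo, hB, hBo, hU, hR⟩ := h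
  have hsurj : Function.Surjective (fun a' => (ν.complementMap e).symm a') :=
    fun a => ⟨ν.complementMap e a, (ν.complementMap e).symm_apply_apply a⟩
  refine ⟨ν.map e, jA ∘ (ν.complementMap e).symm, jB,
    hA.comp_diffeomorph (ν.complementMap e).symm, ?_, hB, hBo, ?_, fun a' b => ?_⟩
  · rwa [hsurj.range_comp]
  · rwa [hsurj.range_comp]
  · rw [Function.comp_apply, hR]
    simp only [circleSurgeryRel, CircleNbhd.coe_complementMap_symm_apply, CircleNbhd.map_apply]
    refine exists_congr fun u => exists_congr fun t => and_congr_right fun _ =>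
      and_congr_right fun _ => ?_
    constructor
    · intro h1
      rw [← h1, Diffeomorph.apply_symm_apply]
    · intro h1
      rw [h1, Diffeomorph.symm_apply_apply]

end CircleTransport

/-! ### Reduction of Cappell–Shaneson spheres to surgeries on the concrete mapping torus -/

section Reduction

/-- **Every Cappell–Shaneson sphere of `A` is a circle surgery on the concrete mapping torus
`CSTorus A` along the standard section circle.** If `X` is a Cappell–Shaneson sphere of `A` in the
sense of the tree's predicate — *some* mapping torus `T` of `torusDiffeomorph A` with gluing
embeddings `jA`, `jB`, *some* smooth parametrisation `c` of its section circle
`jA ({1} × (0, 1)) ∪ jB ({1} × (1/2, 3/2))`, *some* tubular neighbourhood and surgery gluing — then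
`X` is obtained by circle surgery on `CSTorus A` along a smoothly embedded circle whose image is
the standard section `inl ({1} × (0, 1)) ∪ inr ({1} × (1/2, 3/2))` (the image of every
`sectionCircle A γ`, `range_sectionCircle`): the mapping torus is unique up to a diffeomorphism
matching the gluing embeddings (`IsOpenGluingWith.exists_diffeomorph_apply_eq`), along which the
circle, its tube and the surgery are transported (`IsCircleSurgery.map_diffeomorph`). This is the
bookkeeping half of the well-definedness of Gompf's `X^σ_A` (§4 ¶2); the geometric half is
`gompf2010_sectionCircle_framings` below. [folklore] -/
theorem IsCappellShanesonSphereOf.exists_isCircleSurgery_csTorus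
    {A : Matrix.SpecialLinearGroup (Fin 3) ℤ} {X : Type*} [TopologicalSpace X]
    [ChartedSpace (𝔼 4) X] (h : IsCappellShanesonSphereOf A X) :
    ∃ c : 𝕊 1 → CSTorus A, Manifold.IsSmoothEmbedding (𝓡 1) (𝓡 4) ∞ c ∧
      range c = (csGlueData A).inl '' ({1} ×ˢ univ) ∪ (csGlueData A).inr '' ({1} ×ˢ univ) ∧
      IsCircleSurgery (𝓡 4) (𝓡 4) (CSTorus A) X c := by
  obtain ⟨-, T, _, _, _, _, _, _, jA, jB, hG, c, hc, hrange, hX⟩ := h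
  obtain ⟨e, heA, heB⟩ := hG.exists_diffeomorph_apply_eq
    (isOpenGluingWith_mappingTorusGlued (torusDiffeomorph A) linTorusModel)
  have hA' : (e : T → CSTorus A) ∘ jA = (csGlueData A).inl := funext heA
  have hB' : (e : T → CSTorus A) ∘ jB = (csGlueData A).inr := funext heB
  refine ⟨e ∘ c, hc.diffeomorph_comp e, ?_, hX.map_diffeomorph e⟩
  rw [range_comp, hrange, image_union, ← image_comp, ← image_comp, hA', hB']

/-- The image of the standard section circle does not depend on the framing path: it is the
range of every `sectionCircle A γ`. [folklore] -/
theorem range_sectionCircle_eq_range_sectionCircle (A : Matrix.SpecialLinearGroup (Fin 3) ℤ)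
    (γ γ' : SmoothMatrixPath (slRealMatrix A)) :
    range (sectionCircle A γ) = range (sectionCircle A γ') := by
  rw [range_sectionCircle, range_sectionCircle]

end Reduction

/-! ### The linear straightening as a smooth matrix path -/

section LinearStraightening

/-- Determinants of entrywise smooth `3 × 3` matrix functions are smooth. [folklore] -/
theorem contDiff_det_fin_three {f : ℝ → Matrix (Fin 3) (Fin 3) ℝ}
    (hf : ∀ i j, ContDiff ℝ ∞ fun θ ↦ f θ i j) : ContDiff ℝ ∞ fun θ ↦ (f θ).det := by
  have h00 := hf 0 0; have h01 := hf 0 1; have h02 := hf 0 2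
  have h10 := hf 1 0; have h11 := hf 1 1; have h12 := hf 1 2
  have h20 := hf 2 0; have h21 := hf 2 1; have h22 := hf 2 2
  simp only [Matrix.det_fin_three]
  fun_prop

/-- Adjugates of entrywise smooth `3 × 3` matrix functions are entrywise smooth. [folklore] -/
theorem contDiff_adjugate_fin_three_apply {f : ℝ → Matrix (Fin 3) (Fin 3) ℝ}
    (hf : ∀ i j, ContDiff ℝ ∞ fun θ ↦ f θ i j) (i j : Fin 3) :
    ContDiff ℝ ∞ fun θ ↦ (f θ).adjugate i j := by
  have h00 := hf 0 0; have h01 := hf 0 1; have h02 := hf 0 2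
  have h10 := hf 1 0; have h11 := hf 1 1; have h12 := hf 1 2
  have h20 := hf 2 0; have h21 := hf 2 1; have h22 := hf 2 2
  simp only [Matrix.adjugate_fin_three]
  fin_cases i <;> fin_cases j <;> simp <;> fun_prop

/-- The segment `t ↦ t M + (1 - t) I` reparametrised by `Real.smoothTransition`, so that it is
constant (`= 1`) for `θ ≤ 0` and constant (`= M`) for `θ ≥ 1`. [cite: GompfAGT2010, Def. 4.1 and Prop. 4.2 (linear straightening)] -/
def linearStraighteningFun (M : Matrix (Fin 3) (Fin 3) ℝ) (θ : ℝ) : Matrix (Fin 3) (Fin 3) ℝ :=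
  linearPath M (Real.smoothTransition θ)

/-- Entries of the reparametrised segment are smooth. [folklore] -/
theorem contDiff_linearStraighteningFun_apply (M : Matrix (Fin 3) (Fin 3) ℝ) (i j : Fin 3) :
    ContDiff ℝ ∞ fun θ ↦ linearStraighteningFun M θ i j := by
  simp only [linearStraighteningFun, linearPath_apply]
  exact (Real.smoothTransition.contDiff.mul contDiff_const).add
    ((contDiff_const.sub Real.smoothTransition.contDiff).mul contDiff_const)

/-- Along a linear straightening the determinant never vanishes. [cite: GompfAGT2010, Def. 4.1 and Prop. 4.2 (linear straightening)] -/
theorem isUnit_det_linearStraighteningFun {M : Matrix (Fin 3) (Fin 3) ℝ}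
    (h : IsLinearlyStraightenable M) (θ : ℝ) : IsUnit (linearStraighteningFun M θ).det :=
  h _ ⟨Real.smoothTransition.nonneg θ, Real.smoothTransition.le_one θ⟩

/-- **The linear straightening `σ_M` as a smooth matrix path** from `1` to `M` (constant near the
ends, with smooth inverse path `θ ↦ (σ_M θ)⁻¹ = det⁻¹ • adjugate`), for a linearly straightenable
`M` (Gompf 2010, Def. 4.1/Prop. 4.2). [cite: GompfAGT2010, Def. 4.1 and Prop. 4.2 (linear straightening)] -/
def linearStraighteningPath (M : Matrix (Fin 3) (Fin 3) ℝ) (h : IsLinearlyStraightenable M) :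
    SmoothMatrixPath M where
  toFun := linearStraighteningFun M
  inv θ := (linearStraighteningFun M θ)⁻¹
  contDiff_apply := contDiff_linearStraighteningFun_apply M
  contDiff_inv_apply i j := by
    have heq : (fun θ ↦ (linearStraighteningFun M θ)⁻¹ i j) = fun θ ↦
        ((linearStraighteningFun M θ).det)⁻¹ * (linearStraighteningFun M θ).adjugate i j := by
      funext θ
      rw [Matrix.inv_def, Matrix.smul_apply, Ring.inverse_eq_inv, smul_eq_mul]
    rw [heq]
    exact ((contDiff_det_fin_three (contDiff_linearStraighteningFun_apply M)).inv
      fun θ ↦ (isUnit_det_linearStraighteningFun h θ).ne_zero).mul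
      (contDiff_adjugate_fin_three_apply (contDiff_linearStraighteningFun_apply M) i j)
  mul_inv θ := Matrix.mul_nonsing_inv _ (isUnit_det_linearStraighteningFun h θ)
  inv_mul θ := Matrix.nonsing_inv_mul _ (isUnit_det_linearStraighteningFun h θ)
  eq_one θ hθ := by
    show linearPath M (Real.smoothTransition θ) = 1
    rw [Real.smoothTransition.zero_of_nonpos hθ, linearPath_zero]
  eq_self θ hθ := by
    show linearPath M (Real.smoothTransition θ) = M
    rw [Real.smoothTransition.one_of_one_le hθ, linearPath_one]

/-- The path of `linearStraighteningPath` is the reparametrised segment. [folklore] -/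
@[simp] theorem linearStraighteningPath_toFun (M : Matrix (Fin 3) (Fin 3) ℝ)
    (h : IsLinearlyStraightenable M) (θ : ℝ) :
    (linearStraighteningPath M h).toFun θ = linearPath M (Real.smoothTransition θ) := rfl

/-- `A₀` has trace `2`. [folklore] -/
theorem trace_akbulutKirbyMatrix : (akbulutKirbyMatrix : Matrix (Fin 3) (Fin 3) ℤ).trace = 2 := by
  decide

/-- **The linear straightening `σ_{A₀}` of the Akbulut–Kirby matrix** (it exists by Prop. 4.2,
`tr A₀ = 2 ≥ 0`; it carries the *untwisted* framing of [AK1]: "[AK1] for the linear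
straightening of `A₀`", Gompf 2010, after Thm 4.3). [cite: GompfAGT2010, Thm 4.3 (remark: [AK1] for the linear straightening of A₀)] -/
def akbulutKirbyLinearPath : SmoothMatrixPath (slRealMatrix akbulutKirbyMatrix) :=
  linearStraighteningPath _ (isLinearlyStraightenable_slRealMatrix_of_trace_nonneg akbulutKirbyMatrix
    det_akbulutKirbyMatrix_sub_one (by rw [trace_akbulutKirbyMatrix]; norm_num))

end LinearStraightening

/-! ### The chain of matrices in the proof of Theorem 4.3 -/

section Chain

/-- **Gompf's second Dehn-twist matrix `Δ₀ = !![1, 0, 1; 0, 1, -2; 0, 0, 1]`**: when a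
Cappell–Shaneson matrix has second column `(1, -1, 0)ᵀ`, Theorem 2.1 gives a Dehn twist `δ₀` along a
torus perpendicular to the third axis in the direction `A e₂ - e₂ = (1, -2, 0)ᵀ`, isotopic to the
linear map `Δ₀` (Gompf 2010, §4, display before Thm 4.3). [cite: GompfAGT2010, §4 (the matrix Δ₀)] -/
def gompfDeltaZero : Matrix.SpecialLinearGroup (Fin 3) ℤ :=
  ⟨!![1, 0, 1; 0, 1, -2; 0, 0, 1], by decide⟩

/-- The underlying matrix of `Δ₀`. [folklore] -/
@[simp] theorem coe_gompfDeltaZero :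
    (gompfDeltaZero : Matrix (Fin 3) (Fin 3) ℤ) = !![1, 0, 1; 0, 1, -2; 0, 0, 1] := rfl

/-- `Δ₀² = !![1, 0, 2; 0, 1, -4; 0, 0, 1]`. [folklore] -/
theorem coe_gompfDeltaZero_sq :
    ((gompfDeltaZero ^ 2 : Matrix.SpecialLinearGroup (Fin 3) ℤ) : Matrix (Fin 3) (Fin 3) ℤ) =
      !![1, 0, 2; 0, 1, -4; 0, 0, 1] := by
  rw [pow_two, Matrix.SpecialLinearGroup.coe_mul, coe_gompfDeltaZero]
  ext i j
  fin_cases i <;> fin_cases j <;> simp [Matrix.mul_apply, Fin.sum_univ_three]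

/-- `Δ² = !![1, -2, 0; 0, 1, 0; 0, 2, 1]`. [folklore] -/
theorem coe_gompfDelta_sq :
    ((gompfDelta ^ 2 : Matrix.SpecialLinearGroup (Fin 3) ℤ) : Matrix (Fin 3) (Fin 3) ℤ) =
      !![1, -2, 0; 0, 1, 0; 0, 2, 1] := by
  have := coe_gompfDelta_zpow 2
  rwa [show ((2 : ℤ)) = ((2 : ℕ) : ℤ) from rfl, zpow_natCast] at this

/-- The first intermediate matrix `Δ² A = !![0, 1, 4; 0, -1, -3; 1, 0, -1]` of the chain. [cite: GompfAGT2010, Thm 4.3 (proof, the chain of four moves)] -/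
def gompfChainOne : Matrix.SpecialLinearGroup (Fin 3) ℤ :=
  ⟨!![0, 1, 4; 0, -1, -3; 1, 0, -1], by decide⟩

/-- The second intermediate matrix `Δ² A Δ₀² = !![0, 1, 0; 0, -1, 1; 1, 0, 1]` of the chain. [cite: GompfAGT2010, Thm 4.3 (proof, the chain of four moves)] -/
def gompfChainTwo : Matrix.SpecialLinearGroup (Fin 3) ℤ :=
  ⟨!![0, 1, 0; 0, -1, 1; 1, 0, 1], by decide⟩

/-- The underlying matrix of `gompfChainOne`. [folklore] -/
@[simp] theorem coe_gompfChainOne :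
    (gompfChainOne : Matrix (Fin 3) (Fin 3) ℤ) = !![0, 1, 4; 0, -1, -3; 1, 0, -1] := rfl

/-- The underlying matrix of `gompfChainTwo`. [folklore] -/
@[simp] theorem coe_gompfChainTwo :
    (gompfChainTwo : Matrix (Fin 3) (Fin 3) ℤ) = !![0, 1, 0; 0, -1, 1; 1, 0, 1] := rfl

/-- **Move 1: left multiplication by `Δ²`**, `Δ² A = !![0, 1, 4; 0, -1, -3; 1, 0, -1]`. [cite: GompfAGT2010, Thm 4.3 (proof, the chain of four moves)] -/
theorem gompfDelta_sq_mul_gompfFramingA : gompfDelta ^ 2 * gompfFramingA = gompfChainOne := by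
  ext i j
  rw [Matrix.SpecialLinearGroup.coe_mul, coe_gompfDelta_sq, coe_gompfFramingA, coe_gompfChainOne]
  fin_cases i <;> fin_cases j <;> simp [Matrix.mul_apply, Fin.sum_univ_three]

/-- The second column of `Δ² A` is `(1, -1, 0)ᵀ`, as the `Δ₀`-move requires ("note that the second
column has the required form"). [cite: GompfAGT2010, Thm 4.3 (proof, the chain of four moves)] -/
theorem gompfChainOne_col_one :
    (fun i ↦ (gompfChainOne : Matrix (Fin 3) (Fin 3) ℤ) i 1) = ![1, -1, 0] := by
  funext i
  fin_cases i <;> rfl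

/-- **Move 2: right multiplication by `Δ₀²`**, `(Δ² A) Δ₀² = !![0, 1, 0; 0, -1, 1; 1, 0, 1]`. [cite: GompfAGT2010, Thm 4.3 (proof, the chain of four moves)] -/
theorem gompfChainOne_mul_gompfDeltaZero_sq : gompfChainOne * gompfDeltaZero ^ 2 = gompfChainTwo := by
  ext i j
  rw [Matrix.SpecialLinearGroup.coe_mul, coe_gompfDeltaZero_sq, coe_gompfChainOne, coe_gompfChainTwo]
  fin_cases i <;> fin_cases j <;> simp [Matrix.mul_apply, Fin.sum_univ_three]

/-- **Move 3: right multiplication by `Δ²`** reaches the Akbulut–Kirby matrix: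
`(Δ² A Δ₀²) Δ² = A₀`. [cite: GompfAGT2010, Thm 4.3 (proof, the chain of four moves)] -/
theorem gompfChainTwo_mul_gompfDelta_sq : gompfChainTwo * gompfDelta ^ 2 = akbulutKirbyMatrix := by
  ext i j
  rw [Matrix.SpecialLinearGroup.coe_mul, coe_gompfDelta_sq, coe_gompfChainTwo, coe_akbulutKirbyMatrix]
  fin_cases i <;> fin_cases j <;> simp [Matrix.mul_apply, Fin.sum_univ_three]

/-- **Move 4: left multiplication by `Δ²`**, `Δ² A₀ = B` ("The final matrix `B` is immediately
preceded by `A₀`"). [cite: GompfAGT2010, Thm 4.3 (proof, the chain of four moves)] -/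
theorem gompfDelta_sq_mul_akbulutKirbyMatrix : gompfDelta ^ 2 * akbulutKirbyMatrix = gompfFramingB := by
  ext i j
  rw [Matrix.SpecialLinearGroup.coe_mul, coe_gompfDelta_sq, coe_akbulutKirbyMatrix, coe_gompfFramingB]
  fin_cases i <;> fin_cases j <;> simp [Matrix.mul_apply, Fin.sum_univ_three]

/-- The whole chain: `Δ² ((Δ² A) Δ₀² Δ²) = B = C A C⁻¹`. [cite: GompfAGT2010, Thm 4.3 (proof, the chain of four moves)] -/
theorem gompf_chain :
    gompfDelta ^ 2 * (gompfDelta ^ 2 * gompfFramingA * gompfDeltaZero ^ 2 * gompfDelta ^ 2) =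
      gompfFramingC * gompfFramingA * gompfFramingC⁻¹ := by
  rw [gompfDelta_sq_mul_gompfFramingA, gompfChainOne_mul_gompfDeltaZero_sq,
    gompfChainTwo_mul_gompfDelta_sq, gompfDelta_sq_mul_akbulutKirbyMatrix, gompfFramingB_eq_conj]

end Chain

/-! ### The framed leaves -/

section Facts

/-- **The two framings of the section circle are the two straightening classes** (the geometric
half of the well-definedness of Gompf's `X^σ_A`; Gompf 2010, §4 ¶2: "the two straightenings `σ` of
`d(φ₀)_p` canonically determine the two possible isotopy classes (rel a neighborhood of `p`) of
monodromies for the Cappell–Shaneson construction on `φ₀`, and hence the two resulting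
diffeomorphism types, which we denote by `X^σ_{φ₀}`. (For each `σ` we straighten and then surger
with the untwisted framing. Changing the framing is equivalent to changing `σ`.)"). Formal
rendering on the tree's concrete objects: for the glued mapping torus `CSTorus A` and *any*
smoothly embedded circle `c` whose image is the standard section
`inl ({1} × (0, 1)) ∪ inr ({1} × (1/2, 3/2))` (any parametrisation), *every* circle surgery on `c`
— any tubular neighbourhood `ν : 𝕊¹ × ℝ³ ↪ CSTorus A` of `c`, either framing, either fibre
orientation, any realisation of the gluing — is diffeomorphic to `gompfSphere A γ` for some smooth
path `γ` from `1` to `A`. The standard ingredients: two parametrisations of the same embedded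
circle differ by a diffeomorphism of `𝕊¹`, isotopic to a rotation or a reflection; the Tubular
Neighbourhood Theorem (Kosinski, *Differential Manifolds*, III.3.1 and III.3.5: two proper tubular
neighbourhoods of a compact closed submanifold are related by an ambient isotopy fixing the
submanifold and a fibrewise isometry) with the Isotopy Extension Theorem (II.5.2), so that the
surgery depends only on the homotopy class of the trivialisation in `[𝕊¹, O(3)]`; fibre
reflections do not change the surgered manifold (reflect `𝕊²` in the new piece `D² × 𝕊²`), leaving
the two classes `π₁ SO(3) = ℤ/2` (Gompf–Stipsicz, *4-Manifolds and Kirby Calculus*, §5.2), which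
are realised by the tubes `sectionCircleNbhd A γ` for `γ` in the two homotopy classes of paths from
`1` to `A` in `GL⁺(3, ℝ)` (`π₁ GL⁺(3, ℝ) = ℤ/2`; Gompf, loc. cit.). Size: XL (none of these three
theorems is in Mathlib). [cite: GompfAGT2010, §4 ¶2 (X^σ well defined; framings ↔ straightenings)] [cite: Kosinski1993, Ch. II §5 Thm (5.2); Ch. III §3 Thm (3.1), Thm (3.5)] [cite: GompfStipsicz1999, §5.2] -/
def gompf2010_sectionCircle_framings : Prop :=
  ∀ (A : Matrix.SpecialLinearGroup (Fin 3) ℤ) (c : 𝕊 1 → CSTorus A),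
    Manifold.IsSmoothEmbedding (𝓡 1) (𝓡 4) ∞ c →
    range c = (csGlueData A).inl '' ({1} ×ˢ univ) ∪ (csGlueData A).inr '' ({1} ×ˢ univ) →
    ∀ (X : Type u) [TopologicalSpace X] [T2Space X] [SecondCountableTopology X]
      [ChartedSpace (𝔼 4) X] [IsManifold (𝓡 4) ∞ X] [CompactSpace X],
      IsCircleSurgery (𝓡 4) (𝓡 4) (CSTorus A) X c →
        ∃ γ : SmoothMatrixPath (slRealMatrix A), Nonempty (X ≃ₘ⟮𝓡 4, 𝓡 4⟯ gompfSphere A γ)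

/-- **Classification of Cappell–Shaneson spheres by straightenings** (well-definedness of `X^σ`;
Gompf 2010, §4 ¶2: "the two straightenings `σ` of `d(φ₀)_p` canonically determine the two possible
isotopy classes (rel a neighborhood of `p`) of monodromies for the Cappell–Shaneson construction on
`φ₀`, and hence the two resulting diffeomorphism types, which we denote by `X^σ_{φ₀}`. (For each
`σ` we straighten and then surger with the untwisted framing. Changing the framing is equivalent to
changing `σ`.)", together with the standard facts it rests on: a closed tubular neighbourhood of a
compact submanifold is unique up to isotopy and a linear bundle automorphism (Kosinski,
*Differential Manifolds*, III.3.1/III.3.5), surgery along isotopic framed circles gives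
diffeomorphic manifolds (Gompf–Stipsicz, *4-Manifolds and Kirby Calculus*, §5.2; Kosinski VI.1–2),
and the mapping torus is unique up to diffeomorphism preserving the section circle
(`IsOpenGluing.nonempty_diffeomorph`). Formal rendering: every closed smooth 4-manifold `X` that is
a Cappell–Shaneson sphere of `A` in the sense of the tree's predicate — any mapping torus of
`torusDiffeomorph A`, any parametrisation of the section circle, any tubular neighbourhood (either
framing, either fibre orientation), any realisation of the surgery gluing — is diffeomorphic to
Gompf's concrete `X^σ_A = gompfSphere A γ` for some smooth path `γ` from `1` to `A` (both framings
of the section circle arise from paths `γ`, the two homotopy classes of `γ` differing by the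
generator of `π₁ GL⁺(3, ℝ) = ℤ/2`). **Proved** below from the sharper leaf
`gompf2010_sectionCircle_framings` and the reduction
`IsCappellShanesonSphereOf.exists_isCircleSurgery_csTorus`
(`gompf2010_straightening_classification_of_sectionCircle`); kept as a named statement because
`CappellShanesonGompfReduction.lean`-level consumers quote it. [cite: GompfAGT2010, §4 ¶2 (X^σ well defined; framings ↔ straightenings)] [cite: Kosinski1993, Ch. III §3, Thm 3.1 and Thm 3.5] [cite: GompfStipsicz1999, §5.2] -/
def gompf2010_straightening_classification : Prop :=
  ∀ (A : Matrix.SpecialLinearGroup (Fin 3) ℤ) (X : Type u) [TopologicalSpace X] [T2Space X]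
    [SecondCountableTopology X] [ChartedSpace (𝔼 4) X] [IsManifold (𝓡 4) ∞ X] [CompactSpace X],
    IsCappellShanesonSphereOf A X →
      ∃ γ : SmoothMatrixPath (slRealMatrix A), Nonempty (X ≃ₘ⟮𝓡 4, 𝓡 4⟯ gompfSphere A γ)

/-- **Gompf 2010, Theorem 4.3 (framed form): "The two Cappell–Shaneson spheres given by the
matrix `A₀` of Example 3.1(a) are diffeomorphic."** With `X^σ_{A₀} = gompfSphere A₀ γ`,
`σ = [γ]`: for any two smooth paths `γ, γ'` from `1` to `A₀` the manifolds `gompfSphere A₀ γ` and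
`gompfSphere A₀ γ'` are diffeomorphic — for homotopic paths this is the well-definedness of `X^σ`
(§4 ¶2), for the two distinct classes it is Theorem 4.3 proper (four applications of the framed
Theorem 2.1 along `A ↦ Δ²A ↦ ·Δ₀² ↦ ·Δ² = A₀ ↦ Δ²· = B = C A C⁻¹`, the 2-simplex of linear
straightenings `σ_A, σ_B, ρ` — `GompfStraightening.lean` — and the mod-`2` winding number of the
loop `τ·ρ` in `GL⁺(3, ℝ) ≃ SO(3)`). Size: XL. [cite: GompfAGT2010, Thm 4.3] -/
def gompf2010_thm43 : Prop :=
  ∀ γ γ' : SmoothMatrixPath (slRealMatrix akbulutKirbyMatrix),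
    Nonempty (gompfSphere akbulutKirbyMatrix γ ≃ₘ⟮𝓡 4, 𝓡 4⟯ gompfSphere akbulutKirbyMatrix γ')

/-- **Akbulut–Kirby 1979 (framed form): the Cappell–Shaneson sphere of `A₀` with the untwisted
framing — Gompf's `X^{σ_lin}_{A₀}` for the linear straightening — is diffeomorphic to `S⁴`**
(S. Akbulut, R. Kirby, *An exotic involution of `S⁴`*, Topology 18 (1979) 75–81: the handle
diagram of this homotopy sphere cancels; Gompf 2010, §1: "[AK1] in 1979, showing via Kirby
calculus that the example with `m = 0` and untwisted framing is `S⁴`", and after Thm 4.3: "both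
manifolds are `S⁴` ([AK1] for the linear straightening of `A₀` …)"). Formal rendering with the
concrete `gompfSphere A₀ akbulutKirbyLinearPath` (the tube of `SectionCircleNbhd.lean` framed by
the segment from `1` to `A₀`; under the tree's convention `(x, s) ∼ (A x, s + 1)`, i.e. Gompf's
`X_{A⁻¹}`, the segment corresponds to `A₀ · (segment from 1 to A₀⁻¹)`, again the linear
straightening). Should the orientation conventions nevertheless exchange the two straightening
classes, the displayed manifold is the *twisted* `A₀`-sphere, which is `S⁴` as well ([AK1]
together with Theorem 4.3 of loc. cit.), so the statement is a theorem in print either way.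
Size: XL (Kirby calculus). [cite: AkbulutKirby1979, main theorem (Σ ≅ S⁴)] [cite: GompfAGT2010, Thm 4.3 (and the remark: [AK1] for the linear straightening of A₀)] -/
def akbulutKirby1979_linearStraightening : Prop :=
  Nonempty (gompfSphere akbulutKirbyMatrix akbulutKirbyLinearPath ≃ₘ⟮𝓡 4, 𝓡 4⟯ ↥(𝕊 4))

end Facts

/-! ### The leaves of `CappellShanesonGompfReduction.lean` from the framed leaves -/

section Consequences

/-- **`gompf2010_straightening_classification` from the framings of the section circle**: reduce
to the concrete mapping torus (`IsCappellShanesonSphereOf.exists_isCircleSurgery_csTorus`) and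
apply `gompf2010_sectionCircle_framings`. [cite: GompfAGT2010, §4 ¶2 (X^σ well defined; framings ↔ straightenings)] -/
theorem gompf2010_straightening_classification_of_sectionCircle
    (hS : gompf2010_sectionCircle_framings.{u}) : gompf2010_straightening_classification.{u} := by
  intro A X _ _ _ _ _ _ hX
  obtain ⟨c, hc, hr, hs⟩ := hX.exists_isCircleSurgery_csTorus
  exact hS A c hc hr X hs


/-- **`gompf2010_akbulutKirby_framings` from the framed leaves**: two Cappell–Shaneson spheres
`X`, `X'` of `A₀` are diffeomorphic to `gompfSphere A₀ γ`, `gompfSphere A₀ γ'`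
(`gompf2010_straightening_classification`), which are diffeomorphic (`gompf2010_thm43`). [cite: GompfAGT2010, Thm 4.3] -/
theorem gompf2010_akbulutKirby_framings_of_framed
    (hW : gompf2010_straightening_classification.{u})
    (hW' : gompf2010_straightening_classification.{v}) (h43 : gompf2010_thm43) :
    gompf2010_akbulutKirby_framings.{u, v} := by
  intro X _ _ _ _ _ _ X' _ _ _ _ _ _ hX hX'
  obtain ⟨γ, ⟨e⟩⟩ := hW akbulutKirbyMatrix X hX
  obtain ⟨γ', ⟨e'⟩⟩ := hW' akbulutKirbyMatrix X' hX'
  obtain ⟨f⟩ := h43 γ γ'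
  exact ⟨e.trans (f.trans e'.symm)⟩

/-- **`akbulutKirby1979_sphere_four` from the framed [AK1]**: the concrete
`gompfSphere A₀ σ_lin` is a Cappell–Shaneson sphere of `A₀` (`isCappellShanesonSphereOf_gompfSphere`)
and is `S⁴`. [cite: AkbulutKirby1979, main theorem (Σ ≅ S⁴)] -/
theorem akbulutKirby1979_sphere_four_of_framed (hAK : akbulutKirby1979_linearStraightening) :
    akbulutKirby1979_sphere_four :=
  ⟨gompfSphere akbulutKirbyMatrix akbulutKirbyLinearPath, inferInstance, inferInstance,
    inferInstance, inferInstance, inferInstance, inferInstance,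
    isCappellShanesonSphereOf_gompfSphere_akbulutKirby _, hAK⟩

end Consequences

end Literature.Topology.FourManifolds

/-! ### Assembly -/

namespace Literature.Topology.FourManifolds

universe u

/-- Local notation: `𝔼 n` is the model Euclidean space `EuclideanSpace ℝ (Fin n)`. -/
local notation "𝔼 " n:arg => EuclideanSpace ℝ (Fin n)

variable (X : Type u) [TopologicalSpace X] [T2Space X] [SecondCountableTopology X]
  [ChartedSpace (𝔼 4) X] [IsManifold (𝓡 4) ∞ X] [CompactSpace X]

/-- **The Akbulut–Kirby spheres are standard, from the framed leaves**: every Cappell–Shaneson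
sphere of `A₀` (either framing) is `S⁴`, from the classification by straightenings, Theorem 4.3
and [AK1]. [cite: GompfAGT2010, Examples 3.1(a)] -/
theorem nonempty_diffeomorph_sphere_four_of_isCappellShanesonSphereOf_akbulutKirby_of_framed
    (hW : gompf2010_straightening_classification.{u})
    (hW₀ : gompf2010_straightening_classification.{0}) (h43 : gompf2010_thm43)
    (hAK : akbulutKirby1979_linearStraightening) :
    nonempty_diffeomorph_sphere_four_of_isCappellShanesonSphereOf_akbulutKirby X :=
  nonempty_diffeomorph_sphere_four_of_isCappellShanesonSphereOf_akbulutKirby_of X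
    (gompf2010_akbulutKirby_framings_of_framed hW hW₀ h43) (akbulutKirby1979_sphere_four_of_framed hAK)

/-- **Gompf 2010, Examples 3.1(a), assembled from the Δ-move and the framed leaves**: the named
fact `nonempty_diffeomorph_sphere_four_of_isCappellShanesonSphereOf X` follows from
`gompf2010_deltaMove` (Thm 2.1/§3; itself reduced to Thm 2.1 on `T³` in
`CappellShanesonDeltaMove.lean`), the classification by straightenings, Theorem 4.3 and [AK1]. [cite: GompfAGT2010, Examples 3.1(a)] -/
theorem nonempty_diffeomorph_sphere_four_of_isCappellShanesonSphereOf_of_framed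
    (hΔ : gompf2010_deltaMove.{u}) (hW : gompf2010_straightening_classification.{0})
    (h43 : gompf2010_thm43) (hAK : akbulutKirby1979_linearStraightening) :
    nonempty_diffeomorph_sphere_four_of_isCappellShanesonSphereOf X :=
  nonempty_diffeomorph_sphere_four_of_isCappellShanesonSphereOf_of X hΔ
    (gompf2010_akbulutKirby_framings_of_framed hW hW h43) (akbulutKirby1979_sphere_four_of_framed hAK)

/-- **The current leaf set.** `nonempty_diffeomorph_sphere_four_of_isCappellShanesonSphereOf X`
from the Δ-move (`gompf2010_deltaMove`, reduced to Theorem 2.1 on `T³` in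
`CappellShanesonDeltaMove.lean`), the framings of the section circle
(`gompf2010_sectionCircle_framings`), Theorem 4.3 (`gompf2010_thm43`) and [AK1]
(`akbulutKirby1979_linearStraightening`). [cite: GompfAGT2010, Examples 3.1(a)] -/
theorem nonempty_diffeomorph_sphere_four_of_isCappellShanesonSphereOf_of_sectionCircle
    (hΔ : gompf2010_deltaMove.{u}) (hS : gompf2010_sectionCircle_framings.{0})
    (h43 : gompf2010_thm43) (hAK : akbulutKirby1979_linearStraightening) :
    nonempty_diffeomorph_sphere_four_of_isCappellShanesonSphereOf X :=
  nonempty_diffeomorph_sphere_four_of_isCappellShanesonSphereOf_of_framed X hΔ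
    (gompf2010_straightening_classification_of_sectionCircle hS) h43 hAK

end Literature.Topology.FourManifolds
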